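import Mathlib
import Literature.Probability.LatticeModels.GaussianPairingBound
import HarnessLib

/-!
# Route MarkovRigidity, support item `FieldRealisation` (stmt-CriticalPhenomena-11245):
# integrability of the Gaussian-pairing dominator

Second helper towards clause (b) of `FieldRealisation`.  The rescaled critical `2m`-point
correlator at non-coincident `x ∈ (ℝ³)^{2m}` is dominated (Newman's Gaussian inequality and the
mesh-uniform kernel bound of `…KernelBound`) by the Wick pairing functional
`𝒢_m[K](x) = pairingSum K m x` of the kernel `K(p,q) = max(1, ‖p − q‖^{-a})`, `a < 3`, uniformly in
the mesh.  For dominated convergence of the smeared sums one needs the INTEGRABILITY of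
`x ↦ (∏ᵢ w(xᵢ)) · 𝒢_m[K](x)` on `(ℝ³)^{2m}` for a rapidly decaying weight `w(p) = (1+‖p‖)^{-N}`.
This file proves it:

* `integrable_weight_mul_kernel` — `(p,q) ↦ w(p) w(q) max(1,‖p−q‖^{-a})` is integrable on
  `ℝ³ × ℝ³` (`a < 3 < N`): split `max(1,r^{-a}) ≤ 1 + 𝟙_{r<1} r^{-a}`, shear `(p,q) ↦ (p, q−p)`
  (`measurePreserving_prod_sub`) and local integrability of `‖u‖^{-a}`
  (`integrableOn_ball_of_norm_le_rpow`);
* `integrable_pairProd` — a product `∏ⱼ h(y_{2j}, y_{2j+1})` of an integrable two-point function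
  over DISJOINT pairs of coordinates is integrable on `(ℝ³)^{2m}` (induction on `m`, splitting off
  the first two coordinates with `measurePreserving_piFinSuccAbove`, as in Mathlib's
  `Integrable.fin_nat_prod`);
* `integrable_weight_mul_pairingSum` — the dominator is integrable: expand the average over
  orderings `τ`, relabel the coordinates by `τ` (`measurePreserving_piCongrLeft`) and regroup the
  weights along the pairs.

References: Glimm–Jaffe 1987 §6.1 (moments of the continuum limit); Aizenman–Duminil-Copin 2021
§6.3 (Gaussian domination).  No definitions are introduced.
-/

noncomputable section

namespace Summit.CriticalPhenomena.Ising3DConformalLimit.MarkovRigidityFieldRealisation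

open MeasureTheory Literature.Probability.LatticeModels
open scoped ENNReal

/-- Shorthand for the continuum `ℝ³`. -/
local notation "E3" => EuclideanSpace ℝ (Fin 3)

/-! ### The two-point piece -/

/-- `max(1, r^{-a}) ≤ 1 + 𝟙_{‖u‖<1} ‖u‖^{-a}` for `a ≥ 0`. [folklore] -/
theorem max_one_rpow_neg_le (a : ℝ) (ha : 0 ≤ a) (u : E3) :
    max 1 (‖u‖ ^ (-a)) ≤ 1 + (Metric.ball (0 : E3) 1).indicator (fun v => ‖v‖ ^ (-a)) u := by
  by_cases hu : u ∈ Metric.ball (0 : E3) 1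
  · rw [Set.indicator_of_mem hu]
    exact max_le (le_add_of_nonneg_right (Real.rpow_nonneg (norm_nonneg _) _))
      (le_add_of_nonneg_left zero_le_one)
  · rw [Set.indicator_of_notMem hu, add_zero]
    refine max_le le_rfl ?_
    rw [Metric.mem_ball, dist_zero_right, not_lt] at hu
    exact Real.rpow_le_one_of_one_le_of_nonpos hu (by linarith)

/-- The weight `(1 + ‖p‖)^{-N}` lies in `[0, 1]`. [folklore] -/
theorem weight_le_one (N : ℝ) (hN : 0 ≤ N) (p : E3) : (1 + ‖p‖) ^ (-N) ≤ 1 :=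
  Real.rpow_le_one_of_one_le_of_nonpos (by linarith [norm_nonneg p]) (by linarith)

/-- The weight `(1 + ‖p‖)^{-N}` is nonnegative. [folklore] -/
theorem weight_nonneg (N : ℝ) (p : E3) : 0 ≤ (1 + ‖p‖) ^ (-N) :=
  Real.rpow_nonneg (by positivity) _

/-- `u ↦ 𝟙_{‖u‖<1} ‖u‖^{-a}` is integrable on `ℝ³` for `a < 3`. [folklore] -/
theorem integrable_indicator_ball_rpow_neg {a : ℝ} (ha : a < 3) :
    Integrable ((Metric.ball (0 : E3) 1).indicator fun v : E3 => ‖v‖ ^ (-a)) := by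
  rw [integrable_indicator_iff Metric.isOpen_ball.measurableSet]
  refine integrableOn_ball_of_norm_le_rpow (by simp) (C := 1) (α := a) (r := 1) ?_ ?_ ?_
  · simpa using ha
  · exact Filter.Eventually.of_forall fun x => by
      rw [one_mul, Real.norm_eq_abs, abs_of_nonneg (Real.rpow_nonneg (norm_nonneg _) _)]
  · exact (measurable_norm.pow_const _).aestronglyMeasurable

/-- The weight `(1 + ‖p‖)^{-N}` is integrable on `ℝ³` for `N > 3`. [folklore] -/
theorem integrable_weight {N : ℝ} (hN : 3 < N) : Integrable fun p : E3 => (1 + ‖p‖) ^ (-N) :=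
  integrable_one_add_norm (by simpa using hN)

/-- **Integrability of the weighted two-point kernel**: for `a < 3 < N`,
`(p, q) ↦ (1+‖p‖)^{-N} (1+‖q‖)^{-N} max(1, ‖p−q‖^{-a})` is integrable on `ℝ³ × ℝ³`.
[cite: GlimmJaffe1987, §6.1] -/
theorem integrable_weight_mul_kernel {a N : ℝ} (ha0 : 0 ≤ a) (ha : a < 3) (hN : 3 < N) :
    Integrable fun z : E3 × E3 =>
      (1 + ‖z.1‖) ^ (-N) * (1 + ‖z.2‖) ^ (-N) * max 1 (‖z.1 - z.2‖ ^ (-a)) := by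
  set w : E3 → ℝ := fun p => (1 + ‖p‖) ^ (-N) with hw
  set j : E3 → ℝ := (Metric.ball (0 : E3) 1).indicator fun v => ‖v‖ ^ (-a) with hj
  have hwi : Integrable w := integrable_weight hN
  have hji : Integrable j := integrable_indicator_ball_rpow_neg ha
  -- the two integrable majorants
  have h1 : Integrable fun z : E3 × E3 => w z.1 * w z.2 := hwi.mul_prod hwi
  have h2 : Integrable fun z : E3 × E3 => w z.1 * j (z.2 - z.1) := by
    have hmp := measurePreserving_prod_sub (volume : Measure E3) (volume : Measure E3)
    have hg : Integrable (fun z : E3 × E3 => w z.1 * j z.2) (volume.prod volume) := hwi.mul_prod hji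
    exact (hmp.integrable_comp hg.aestronglyMeasurable).mpr hg
  refine (h1.add h2).mono' ?_ ?_
  · refine Measurable.aestronglyMeasurable ?_
    refine ((measurable_fst.norm.const_add 1).pow_const _).mul
      ((measurable_snd.norm.const_add 1).pow_const _) |>.mul ?_
    exact measurable_const.max ((measurable_fst.sub measurable_snd).norm.pow_const _)
  · refine Filter.Eventually.of_forall fun z => ?_
    have hw1 : 0 ≤ w z.1 := weight_nonneg N z.1
    have hw2 : 0 ≤ w z.2 := weight_nonneg N z.2
    have hw2' : w z.2 ≤ 1 := weight_le_one N (by linarith) z.2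
    have hmax : 0 ≤ max 1 (‖z.1 - z.2‖ ^ (-a)) := le_trans zero_le_one (le_max_left _ _)
    have hjsymm : j (z.1 - z.2) = j (z.2 - z.1) := by
      simp only [hj, Set.indicator, Metric.mem_ball, dist_zero_right, norm_sub_rev]
    rw [Real.norm_eq_abs, abs_of_nonneg (mul_nonneg (mul_nonneg hw1 hw2) hmax)]
    calc w z.1 * w z.2 * max 1 (‖z.1 - z.2‖ ^ (-a))
        ≤ w z.1 * w z.2 * (1 + j (z.1 - z.2)) :=
          mul_le_mul_of_nonneg_left (max_one_rpow_neg_le a ha0 _) (mul_nonneg hw1 hw2)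
      _ = w z.1 * w z.2 + w z.1 * (w z.2 * j (z.1 - z.2)) := by ring
      _ ≤ w z.1 * w z.2 + w z.1 * (1 * j (z.1 - z.2)) := by
          have hj0 : 0 ≤ j (z.1 - z.2) := by
            simp only [hj, Set.indicator]
            split_ifs
            · exact Real.rpow_nonneg (norm_nonneg _) _
            · exact le_rfl
          gcongr
      _ = w z.1 * w z.2 + w z.1 * j (z.2 - z.1) := by rw [one_mul, hjsymm]

/-! ### Products over disjoint pairs of coordinates -/

/-- The first pair of indices: `pairIdx (m+1) (0,0) = 0`. [folklore] -/
theorem pairIdx_zero_zero (m : ℕ) : (pairIdx (m + 1) (0, 0) : Fin (2 * (m + 1))) = 0 := by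
  ext; simp [pairIdx_apply_val]

/-- The first pair of indices: `pairIdx (m+1) (0,1) = 1 = succ 0`. [folklore] -/
theorem pairIdx_zero_one (m : ℕ) :
    (pairIdx (m + 1) (0, 1) : Fin (2 * (m + 1))) = (0 : Fin (2 * m + 1)).succ := by
  ext; simp [pairIdx_apply_val]; exact (Nat.mod_eq_of_lt (by omega)).symm

/-- **Recursion of the pair product**: splitting off the first pair,
`∏_{j<m+1} h(y_{2j}, y_{2j+1}) = h(y₀, y₁) · ∏_{j<m} h(y_{2j+2}, y_{2j+3})`. [folklore] -/
theorem pairProd_succ (h : E3 × E3 → ℝ) (m : ℕ) (y : Fin (2 * (m + 1)) → E3) :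
    ∏ j : Fin (m + 1), h (y (pairIdx (m + 1) (j, 0)), y (pairIdx (m + 1) (j, 1))) =
      h (y 0, y (0 : Fin (2 * m + 1)).succ) *
        ∏ j : Fin m, h (y (pairIdx m (j, 0)).succ.succ, y (pairIdx m (j, 1)).succ.succ) := by
  rw [Fin.prod_univ_succ, pairIdx_zero_zero, pairIdx_zero_one]
  simp_rw [pairIdx_succ]

/-- **Integrability of products over disjoint pairs.**  If `h` is integrable on `ℝ³ × ℝ³`, then
`y ↦ ∏_{j<m} h(y_{2j}, y_{2j+1})` is integrable on `(ℝ³)^{2m}` (induction on `m`; the first two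
coordinates are split off with `measurePreserving_piFinSuccAbove`, the factors are separated with
`Integrable.mul_prod`, cf. Mathlib's `Integrable.fin_nat_prod`). [folklore] -/
theorem integrable_pairProd {h : E3 × E3 → ℝ} (hint : Integrable h (volume.prod volume)) :
    ∀ m : ℕ, Integrable (fun y : Fin (2 * m) → E3 =>
      ∏ j : Fin m, h (y (pairIdx m (j, 0)), y (pairIdx m (j, 1)))) (Measure.pi fun _ => volume)
  | 0 => by
    simp only [Finset.univ_eq_empty, Finset.prod_empty]
    have hE : IsEmpty (Fin (2 * 0)) := by rw [Nat.mul_zero]; infer_instance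
    have : IsFiniteMeasure (Measure.pi fun _ : Fin (2 * 0) => (volume : Measure E3)) := by
      rw [isFiniteMeasure_iff, Measure.pi_empty_univ]; exact ENNReal.one_lt_top
    exact integrable_const 1
  | m + 1 => by
    have ih := integrable_pairProd hint m
    -- the integrand after splitting off the coordinates `0` and `1`
    set G'' : (E3 × E3) × (Fin (2 * m) → E3) → ℝ := fun q =>
      h q.1 * ∏ j : Fin m, h (q.2 (pairIdx m (j, 0)), q.2 (pairIdx m (j, 1))) with hG''def
    have hG'' : Integrable G'' ((volume.prod volume).prod (Measure.pi fun _ => volume)) :=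
      hint.mul_prod ih
    -- reassociate: `G' (a, (b, r)) = h (a, b) * P r`
    set G' : E3 × (E3 × (Fin (2 * m) → E3)) → ℝ := G'' ∘ (MeasurableEquiv.prodAssoc).symm with hG'def
    have hG' : Integrable G' (volume.prod (volume.prod (Measure.pi fun _ => volume))) :=
      ((measurePreserving_prodAssoc (volume : Measure E3) (volume : Measure E3)
        (Measure.pi fun _ : Fin (2 * m) => (volume : Measure E3))).symm
        (MeasurableEquiv.prodAssoc)).integrable_comp_emb
          (MeasurableEquiv.measurableEmbedding _) |>.2 hG''
    -- peel coordinate `0` of the tail: `G (a, g) = G' (a, (g 0, g ∘ succ))`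
    set e1 := MeasurableEquiv.piFinSuccAbove (fun _ : Fin (2 * m + 1) => E3) 0 with he1
    have he1mp : MeasurePreserving e1 (Measure.pi fun _ => volume)
        (volume.prod (Measure.pi fun _ => volume)) :=
      measurePreserving_piFinSuccAbove (fun _ : Fin (2 * m + 1) => (volume : Measure E3)) 0
    set G : E3 × (Fin (2 * m + 1) → E3) → ℝ := G' ∘ Prod.map id e1 with hGdef
    have hGint : Integrable G (volume.prod (Measure.pi fun _ => volume)) :=
      (((MeasurePreserving.id (volume : Measure E3)).prod he1mp).integrable_comp_emb
        ((MeasurableEmbedding.id).prodMap e1.measurableEmbedding)).2 hG'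
    -- peel coordinate `0`: the pair product is `G ∘ e0`
    set e0 := MeasurableEquiv.piFinSuccAbove (fun _ : Fin (2 * m + 2) => E3) 0 with he0
    have he0mp : MeasurePreserving e0 (Measure.pi fun _ => volume)
        (volume.prod (Measure.pi fun _ => volume)) :=
      measurePreserving_piFinSuccAbove (fun _ : Fin (2 * m + 2) => (volume : Measure E3)) 0
    have key : (fun y : Fin (2 * (m + 1)) → E3 =>
        ∏ j : Fin (m + 1), h (y (pairIdx (m + 1) (j, 0)), y (pairIdx (m + 1) (j, 1)))) = G ∘ e0 := by
      funext y
      rw [pairProd_succ]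
      simp [hGdef, hG'def, hG''def, he0, he1, MeasurableEquiv.piFinSuccAbove_apply,
        MeasurableEquiv.prodAssoc, Fin.tail]
    rw [key]
    exact (he0mp.integrable_comp_emb e0.measurableEmbedding).2 hGint

/-! ### The pairing-sum dominator -/

/-- Regrouping the one-point weights along the pairs of an ordering `τ`:
`∏ᵢ w(xᵢ) = ∏ⱼ w(x_{τ(2j)}) w(x_{τ(2j+1)})`. [folklore] -/
theorem prod_eq_prod_pairs (w : E3 → ℝ) (m : ℕ) (x : Fin (2 * m) → E3)
    (τ : Equiv.Perm (Fin (2 * m))) :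
    ∏ i, w (x i) = ∏ j : Fin m, (w (x (τ (pairIdx m (j, 0)))) * w (x (τ (pairIdx m (j, 1))))) := by
  calc ∏ i, w (x i) = ∏ i, w (x (τ i)) := (Equiv.prod_comp τ (fun i => w (x i))).symm
    _ = ∏ p : Fin m × Fin 2, w (x (τ (pairIdx m p))) :=
        (Fintype.prod_equiv (pairIdx m) _ _ fun _ => rfl).symm
    _ = ∏ j : Fin m, (w (x (τ (pairIdx m (j, 0)))) * w (x (τ (pairIdx m (j, 1))))) := by
        rw [Fintype.prod_prod_type]
        refine Finset.prod_congr rfl fun j _ => ?_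
        rw [Fin.prod_univ_two]

/-- **Integrability of the Gaussian-pairing dominator.**  For `0 ≤ a < 3 < N` and every `m`,
`x ↦ (∏ᵢ (1+‖xᵢ‖)^{-N}) · 𝒢_m[max(1,‖·−·‖^{-a})](x)` is integrable on `(ℝ³)^{2m}`: expand the
average over orderings, relabel the coordinates (`measurePreserving_piCongrLeft`), regroup the
weights along the pairs and apply `integrable_pairProd` to the weighted two-point kernel.
[cite: GlimmJaffe1987, §6.1] -/
theorem integrable_weight_mul_pairingSum {a N : ℝ} (ha0 : 0 ≤ a) (ha : a < 3) (hN : 3 < N)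
    (m : ℕ) :
    Integrable (fun x : Fin (2 * m) → E3 =>
      (∏ i, (1 + ‖x i‖) ^ (-N)) * pairingSum (fun p q : E3 => max 1 (‖p - q‖ ^ (-a))) m x)
      (Measure.pi fun _ => volume) := by
  set w : E3 → ℝ := fun p => (1 + ‖p‖) ^ (-N) with hw
  set K : E3 → E3 → ℝ := fun p q => max 1 (‖p - q‖ ^ (-a)) with hK
  set h : E3 × E3 → ℝ := fun z => w z.1 * w z.2 * K z.1 z.2 with hh
  have hint : Integrable h (volume.prod volume) := integrable_weight_mul_kernel ha0 ha hN
  -- the integrable pair product and its relabellings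
  set T : (Fin (2 * m) → E3) → ℝ := fun y =>
    ∏ j : Fin m, h (y (pairIdx m (j, 0)), y (pairIdx m (j, 1))) with hT
  have hTint : Integrable T (Measure.pi fun _ => volume) := integrable_pairProd hint m
  have hTτ : ∀ τ : Equiv.Perm (Fin (2 * m)),
      Integrable (fun x : Fin (2 * m) → E3 => T (x ∘ τ)) (Measure.pi fun _ => volume) := by
    intro τ
    have hmp := measurePreserving_piCongrLeft (fun _ : Fin (2 * m) => (volume : Measure E3)) τ.symm
    have hcomp : (fun x : Fin (2 * m) → E3 => T (x ∘ τ)) =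
        T ∘ (MeasurableEquiv.piCongrLeft (fun _ : Fin (2 * m) => E3) τ.symm) := by
      funext x
      simp only [Function.comp_apply, MeasurableEquiv.coe_piCongrLeft]
      congr 1
      funext i
      rw [Function.comp_apply, Equiv.piCongrLeft_apply_eq_cast, cast_eq, Equiv.symm_symm]
    rw [hcomp]
    exact (hmp.integrable_comp_emb (MeasurableEquiv.measurableEmbedding _)).2 hTint
  -- expand the pairing functional
  have hexp : (fun x : Fin (2 * m) → E3 => (∏ i, w (x i)) * pairingSum K m x) =
      fun x => ((2 : ℝ) ^ m * m.factorial)⁻¹ *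
        ∑ τ : Equiv.Perm (Fin (2 * m)), T (x ∘ τ) := by
    funext x
    rw [pairingSum, mul_left_comm, Finset.mul_sum]
    congr 1
    refine Finset.sum_congr rfl fun τ _ => ?_
    rw [prod_eq_prod_pairs w m x τ, hT]
    simp only [Function.comp_apply, hh]
    rw [← Finset.prod_mul_distrib]
  change Integrable (fun x : Fin (2 * m) → E3 => (∏ i, w (x i)) * pairingSum K m x)
    (Measure.pi fun _ => volume)
  rw [hexp]
  exact (integrable_finsetSum _ fun τ _ => hTτ τ).const_mul _

end Summit.CriticalPhenomena.Ising3DConformalLimit.MarkovRigidityFieldRealisation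

end
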